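import Summits.QuantumFields.YangMills.Theorems.FluctuationComparisonRegPrIntLOrganTangentWindowAbsContFromHeight
import Summits.QuantumFields.YangMills.Theorems.FluctuationComparisonRegPrIntLOrganTangentSeparabilitySwap
import Summits.QuantumFields.YangMills.Theorems.FluctuationComparisonRegPrIntLOrganTangentFibreMeanToolsAnyCut
import Literature.MathematicalPhysics.QuantumFieldTheory.Balaban1983to89.T3MinimiserStabilityReduction
import HarnessLib

/-!
# Crux `FluctuationComparisonRegPrIntL` (stmt-QuantumFields-20520, rung R3), PATH-B organ O1, LINE g25-3 «version_coarea» (ideator ym-r3-idea-1 g25), row COAREA∘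
# `RegularFibrePackageCan` — **CLOSED OUTRIGHT, FOR EVERY FAMILY**: the regular small-field fibre package with the FULL disintegration clause
# (every disintegration `σ`, `dU_j`-a.e., every continuous test function inside the a.e.) from a height

LEAD-20520 width seat ym-ust-20520-w3 g23 (cell ym3-torus), `--supports stmt-QuantumFields-20520` (helper).  THEOREMS ONLY, def-free; conclusion = tree
`Cruxes/FluctuationComparisonRegPrIntL/Lines/version_coarea.lean` v1.4 `RegularFibrePackageCan` BODY with its `sfCut θ U` inlined as the token
`∏ p, max 0 (min 1 ((24∕25·θ − dist1(U(∂p)))∕((24∕25 − 1∕2)·θ)))` (the file's own `def sfCut`, unfolded).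

★★★`regularFibrePackageCan_holds`.  ASSEMBLY of four landed theorems: (A) ✓(L8) `…APackageFromHeight.exists_height_regularSmallFieldDisintegration` (w5 g21:
ONE disintegration `σ₀`, the family `λ`, (A1)(A2)(A3) at `24∕25`, `ν := descend_* dU_{j+1}`-a.e., test function outside); (t′) ✓p790952 `…WindowAbsContFromHeight.
exists_height_window_absCont` (w5 g21 (L11): `(dU_j)|_{window} ≪ ν` from a height, over LEAD's ✓p790365 (t)); (u) ✓TOOLS `ae_eq_of_bind_of_bind` (disintegration uniqueness `σ = σ₀` ν-a.e.);
(s) ✓`…SeparabilitySwap.ae_forall_fibreIdentity_of_forall_ae` (test function inside the a.e.).  Then: (i) every continuous `g` is `λ_V`-integrable (finite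
measure, compact space); (ii) = (A1) after «`g = 0` where the cutoff vanishes» ⟹ «`g ≠ 0` only on the `24∕25`-window» (✓TOOLSc `plaqSmall_of_sfCutRamp_ne_zero`);
(iii) = (A2); (iv) for every `σ`: (A3) ∘ (u) gives the identity ν-a.e. on the window for each `g`, (t′) transfers it to `dU_j`-a.e., (s) puts `g` inside, and
`φ := c⁻¹`.

So LINE g25-3 «version_coarea» has BOTH rows as theorems (PINCH∘ ✓p781960 w5 g20; COAREA∘ here) and its junction ✓`fibreMeanVersion_of_coarea` re-proves
VER∘ — a second, independent kernel route to RECORD 17eq besides ✓`…VersionClosed`.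

HONEST FRAMING: measure theory over landed chart∕law∕lift theorems; nothing of Bałaban's renormalization-group analysis is asserted or proved; COAREA∘ is a
REGULARITY FRAME (small-field fibre laws are a continuous family), not an estimate; LIN∘, JEN∘∕JVAR∘, O1 (any currency), crux 20520, `YM3TorusSU2` are NOT
proved; registry `Lines/semiclassical_s2beta.lean` v11.4 (★★OWNER RULING №36) untouched, nothing here is registered; rung R3 = SU(2) YM₃ on T³ — NOT d = 4,
NOT infinite volume, NOT a mass gap, NOT Clay; the Yang–Mills mass gap is NOT proved by any of this.
-/

set_option autoImplicit false

noncomputable section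

namespace Summit.QuantumFields.YangMills.Theorems.OrganTangentCoareaClosed

open MeasureTheory ProbabilityTheory Filter Topology Set Function
open scoped ENNReal NNReal
open Literature.MathematicalPhysics.QuantumFieldTheory.Balaban1983to89
open T3ContinuumYM3Torus T3NestedUnitLaws T3UnitLawDensityEML T3UnitScaleTilt T3LevelShift
open Literature.MathematicalPhysics.QuantumFieldTheory.Balaban1983to89.T3OrbitAverage
open Summit.QuantumFields.YangMills.Theorems.OrganTangentFibreMeanTools (ae_eq_of_bind_of_bind integrable_of_continuous_compact)
open Summit.QuantumFields.YangMills.Theorems.OrganTangentFibreMeanToolsAnyCut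
  (plaqSmall_of_sfCutRamp_ne_zero sfCutRamp_pos_iff_plaqSmall sfCutRamp_nonneg half_lt_twentyFour_div_twentyFive_and_lt_one)
open Summit.QuantumFields.YangMills.Theorems.FluctuationComparisonRegPrIntLOrganTangentAPackageFromHeight (exists_height_regularSmallFieldDisintegration)
open Summit.QuantumFields.YangMills.Theorems.FluctuationComparisonRegPrIntLOrganTangentWindowAbsContFromHeight (exists_height_window_absCont)
open Summit.QuantumFields.YangMills.Theorems.OrganTangentSeparabilitySwap (ae_forall_fibreIdentity_of_forall_ae)

/-- ★★★ **COAREA∘ (`RegularFibrePackageCan`, LINE g25-3 v1.4) HOLDS FOR EVERY FAMILY** — see the module docstring.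
[cite: Balaban1985Averaging, (10)-(13) p.19; Balaban1987RG1, (0.4) p.253 and (0.13) p.254] -/
theorem regularFibrePackageCan_holds :
    ∀ (F : T3Family) (γ b₀ p₀ : ℝ), 0 < γ → γ ≤ 1 → 0 < b₀ → 0 < p₀ → ∃ jV : ℕ, ∀ (j : ℕ), jV ≤ j → ∃ (lam : GaugeField (F.P j) 0 ↥(Matrix.specialUnitaryGroup (Fin 2) ℂ) → MeasureTheory.Measure (GaugeField (F.P (j + 1)) 0 ↥(Matrix.specialUnitaryGroup (Fin 2) ℂ))), (∀ (V : GaugeField (F.P j) 0 ↥(Matrix.specialUnitaryGroup (Fin 2) ℂ)) (g : GaugeField (F.P (j + 1)) 0 ↥(Matrix.specialUnitaryGroup (Fin 2) ℂ) → ℝ), Continuous g → MeasureTheory.Integrable g (lam V)) ∧ (∀ (g : GaugeField (F.P (j + 1)) 0 ↥(Matrix.specialUnitaryGroup (Fin 2) ℂ) → ℝ), Continuous g → (∀ U, (∏ p : Plaq (F.P (j + 1)) 0, max 0 (min 1 ((24 / 25 * θBal F.L γ b₀ p₀ (j + 1) - dist1 (GaugeField.plaqHol U p)) / ((24 / 25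 - 1 / 2) * θBal F.L γ b₀ p₀ (j + 1))))) = 0 → g U = 0) → ContinuousOn (fun V => ∫ U, g U ∂(lam V)) {V | PlaqSmall (θBal F.L γ b₀ p₀ j) V}) ∧ (∀ (V : GaugeField (F.P j) 0 ↥(Matrix.specialUnitaryGroup (Fin 2) ℂ)), PlaqSmall (θBal F.L γ b₀ p₀ j) V → 0 < lam V {U | PlaqSmall (24 / 25 * θBal F.L γ b₀ p₀ (j + 1)) U}) ∧ (∀ (σ : ProbabilityTheory.Kernel (GaugeField (F.P j) 0 ↥(Matrix.specialUnitaryGroup (Fin 2) ℂ)) (GaugeField (F.P (j + 1)) 0 ↥(Matrix.specialUnitaryGroup (Fin 2) ℂ))), ProbabilityTheory.IsMarkovKernel σ → (Measure.map (descend F ℰp j) (fieldMeasure (F.P (j + 1)) 0 ↥(Matrix.specialUnitaryGroup (Fin 2) ℂ))).bind ⇑σ = fieldMeasure (F.P (j + 1)) 0 ↥(Matrix.specialUnitaryGroup (Fin 2) ℂ) → (∀ᵐ V ∂(Measure.map (descend F ℰp j) (fieldMeasure (F.P (j + 1)) 0 ↥(Matrix.specialUnitaryGroup (Fin 2) ℂ))),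 ∀ᵐ U ∂(σ V), descend F ℰp j U = V) → ∃ (φ : GaugeField (F.P j) 0 ↥(Matrix.specialUnitaryGroup (Fin 2) ℂ) → ℝ), ∀ᵐ V ∂(fieldMeasure (F.P j) 0 ↥(Matrix.specialUnitaryGroup (Fin 2) ℂ)), PlaqSmall (θBal F.L γ b₀ p₀ j) V → 0 < φ V ∧ ∀ (g : GaugeField (F.P (j + 1)) 0 ↥(Matrix.specialUnitaryGroup (Fin 2) ℂ) → ℝ), Continuous g → (∀ U, (∏ p : Plaq (F.P (j + 1)) 0, max 0 (min 1 ((24 / 25 * θBal F.L γ b₀ p₀ (j + 1) - dist1 (GaugeField.plaqHol U p)) / ((24 / 25 - 1 / 2) * θBal F.L γ b₀ p₀ (j + 1))))) = 0 → g U = 0) → MeasureTheory.Integrable g (σ V) ∧ ∫ U, g U ∂(σ V) = (φ V)⁻¹ * ∫ U, g U ∂(lam V)) := by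
  intro F γ b₀ p₀ hγ hγ1 hb₀ hp₀
  obtain ⟨jA, hjA⟩ := exists_height_regularSmallFieldDisintegration F γ b₀ p₀ hγ hγ1 hb₀ hp₀
  obtain ⟨jB, hjB⟩ := exists_height_window_absCont F γ b₀ p₀ hγ hγ1 hb₀ hp₀
  refine ⟨max jA jB, fun j hj => ?_⟩
  obtain ⟨σ₀, lam, hσ₀M, hbind₀, hfib₀, hlam, hA1, hA2, hA3⟩ := hjA j (le_of_max_le_left hj)
  have hac := hjB j (le_of_max_le_right hj)
  haveI := hσ₀M
  haveI : BorelSpace (GaugeField (F.P (j + 1)) 0 ↥(Matrix.specialUnitaryGroup (Fin 2) ℂ)) := instBorelSpaceGaugeField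
  haveI : BorelSpace (GaugeField (F.P j) 0 ↥(Matrix.specialUnitaryGroup (Fin 2) ℂ)) := instBorelSpaceGaugeField
  set Hf : Measure (GaugeField (F.P (j + 1)) 0 ↥(Matrix.specialUnitaryGroup (Fin 2) ℂ)) := fieldMeasure (F.P (j + 1)) 0 ↥(Matrix.specialUnitaryGroup (Fin 2) ℂ) with hHf
  set Hc : Measure (GaugeField (F.P j) 0 ↥(Matrix.specialUnitaryGroup (Fin 2) ℂ)) := fieldMeasure (F.P j) 0 ↥(Matrix.specialUnitaryGroup (Fin 2) ℂ) with hHc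
  haveI : IsProbabilityMeasure Hf := Missing.isProbabilityMeasure_fieldMeasure _ _
  haveI : Nonempty (GaugeField (F.P (j + 1)) 0 ↥(Matrix.specialUnitaryGroup (Fin 2) ℂ)) := ⟨fun _ => 1⟩
  have hd : Measurable (descend F ℰp j : GaugeField (F.P (j + 1)) 0 ↥(Matrix.specialUnitaryGroup (Fin 2) ℂ) → GaugeField (F.P j) 0 ↥(Matrix.specialUnitaryGroup (Fin 2) ℂ)) :=
    T3NestedUnitLaws.measurable_descend F ℰp measurableE_ℰp j
  have hθ : 0 < θBal F.L γ b₀ p₀ (j + 1) := T3MinimiserStabilityReduction.θBal_pos F.hL.2.le hγ hγ1 hb₀ p₀ (j + 1)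
  have hc12 : (1 / 2 : ℝ) < 24 / 25 := half_lt_twentyFour_div_twentyFive_and_lt_one.1
  -- the window is open, hence measurable
  set W : Set (GaugeField (F.P j) 0 ↥(Matrix.specialUnitaryGroup (Fin 2) ℂ)) := {V | PlaqSmall (θBal F.L γ b₀ p₀ j) V} with hW
  have hWm : MeasurableSet W := by
    have e : W = ⋂ p : Plaq (F.P j) 0, {V | dist1 (GaugeField.plaqHol V p) < θBal F.L γ b₀ p₀ j} := by
      ext V; simp only [hW, PlaqSmall, Set.mem_setOf_eq, Set.mem_iInter]
    rw [e]
    exact (isOpen_iInter_of_finite fun p => isOpen_lt (OrganTangentFibreMeanTools.continuous_dist1_plaqHol p) continuous_const).measurableSet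
  -- the cutoff token vanishes exactly off the `24∕25`-window
  have htok0 : ∀ U : GaugeField (F.P (j + 1)) 0 ↥(Matrix.specialUnitaryGroup (Fin 2) ℂ), ¬ PlaqSmall (24 / 25 * θBal F.L γ b₀ p₀ (j + 1)) U →
      (∏ p : Plaq (F.P (j + 1)) 0, max 0 (min 1 ((24 / 25 * θBal F.L γ b₀ p₀ (j + 1) - dist1 (GaugeField.plaqHol U p)) /
        ((24 / 25 - 1 / 2) * θBal F.L γ b₀ p₀ (j + 1))))) = 0 := fun U hU =>
    le_antisymm (not_lt.mp fun h => hU ((sfCutRamp_pos_iff_plaqSmall hc12 hθ U).mp h)) (sfCutRamp_nonneg _ _ _ U)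
  refine ⟨lam, fun V g hg => ?_, fun g hg hg0 => ?_, hA2, fun σ hσM hbind hfib => ?_⟩
  · haveI := hlam V; exact integrable_of_continuous_compact hg _
  · exact hA1 g hg fun U hU => plaqSmall_of_sfCutRamp_ne_zero hc12 hθ U fun h0 => hU (hg0 U h0)
  · haveI := hσM
    obtain ⟨c, hc⟩ := hA3
    -- (u) uniqueness of the disintegration
    have huniq : ∀ᵐ V ∂(Hf.map (descend F ℰp j)), σ V = σ₀ V := ae_eq_of_bind_of_bind Hf hd σ σ₀ hbind hfib hbind₀ hfib₀
    -- (A3) for `σ`, ν-a.e. on the window, one test function at a time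
    have h1 : ∀ f : GaugeField (F.P (j + 1)) 0 ↥(Matrix.specialUnitaryGroup (Fin 2) ℂ) → ℝ, Continuous f →
        (∀ U, ¬ PlaqSmall (24 / 25 * θBal F.L γ b₀ p₀ (j + 1)) U → f U = 0) →
        ∀ᵐ V ∂(Hf.map (descend F ℰp j)), V ∈ W → 0 < c V ∧ ∫ U, f U ∂(σ V) = c V * ∫ U, f U ∂(lam V) := by
      intro f hf hf0
      filter_upwards [hc f hf hf0, huniq] with V hV hVσ hVW
      rw [hVσ]; exact hV hVW
    -- (t′) transfer to `dU_j`-a.e. on the window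
    have h2 : ∀ f : GaugeField (F.P (j + 1)) 0 ↥(Matrix.specialUnitaryGroup (Fin 2) ℂ) → ℝ, Continuous f →
        (∀ U, ¬ PlaqSmall (24 / 25 * θBal F.L γ b₀ p₀ (j + 1)) U → f U = 0) →
        ∀ᵐ V ∂Hc, V ∈ W → 0 < c V ∧ ∫ U, f U ∂(σ V) = c V * ∫ U, f U ∂(lam V) := by
      intro f hf hf0
      have h : ∀ᵐ V ∂(Hc.restrict W), V ∈ W → 0 < c V ∧ ∫ U, f U ∂(σ V) = c V * ∫ U, f U ∂(lam V) :=
        hac.ae_le (h1 f hf hf0)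
      rw [ae_restrict_iff' hWm] at h
      filter_upwards [h] with V hV hVW
      exact hV hVW hVW
    have hcpos : ∀ᵐ V ∂Hc, V ∈ W → 0 < c V := by
      filter_upwards [h2 (fun _ => 0) continuous_const fun _ _ => rfl] with V hV hVW
      exact (hV hVW).1
    -- (s) the test function inside the a.e.
    have h3 := ae_forall_fibreIdentity_of_forall_ae F γ b₀ p₀ j (24 / 25) Hc (fun V => (σ V : Measure (GaugeField (F.P (j + 1)) 0 ↥(Matrix.specialUnitaryGroup (Fin 2) ℂ)))) lam
      (fun V => inferInstance) hlam c fun g hg hg0 => by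
        filter_upwards [h2 g hg hg0] with V hV hVW
        exact (hV hVW).2
    refine ⟨fun V => (c V)⁻¹, ?_⟩
    filter_upwards [hcpos, h3] with V hcV h3V hVW
    refine ⟨inv_pos.2 (hcV hVW), fun g hg hg0 => ⟨integrable_of_continuous_compact hg _, ?_⟩⟩
    rw [inv_inv]
    exact h3V hVW g hg fun U hU => hg0 U (htok0 U hU)

end Summit.QuantumFields.YangMills.Theorems.OrganTangentCoareaClosed

end
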